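import Summits.Ventures.Crystal3D.Theorems.StickyWulffConstantTextureLiminfTexShadowSplitDefsV5
import HarnessLib

/-!
# TexShadow v8 vocabulary — the «BothFcc-FIRST» cut at cap `c₀`: the whole `BothFcc` half as ONE cell statement, and the FAULTED
# restrictions of the two remaining generic-side stubs (T-V5 PORT; lane T, crux `TextureLiminfV5`, stmt-Ventures-23912;
# cf-p1 DECISION (lxxxii), 2026-08-29T01:46:40Z)

HONEST FRAMING. Venture `Summits/Ventures/Crystal3D` (cell `crystal3d-full`), route `route-Ventures-StickyWulffConstant`, helper
`--supports` the law-v5 crux `TextureLiminfV5` (stmt-Ventures-23912).  DEFINITIONS + one-line inclusions only; nothing about any wall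
law is proved or claimed; rung F-C1 not moved.

THE CUT (cf-p1 (lxxxii), on wulff-p2's Q2).  At law v5 lane G prices EVERY non-co-axial pair of affine fcc lattices at charge `c₀` with ONE
constant (`hG`, the output of 19480-p2's `genericWallFloorWithCharge_all_of_coverage`), so every `BothFcc` plate pair closes from {zero cell,
F-U, hG} alone (`bilayerWallAt_of_bothFcc_ledgerWith`, …TexShadowBetaIIIAtBridge p686715) — no walker machinery, no payer pool, no
residual, no `hgen`.  The top split of the two-plate wall law therefore becomes `by_cases BothFcc σ₁ σ₂` FIRST, and every stub that
survives on the T side is its FAULTED (`¬BothFcc`) restriction: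
* `BilayerWallBothFccAt c₀ C R₀` — the whole `BothFcc` half at cap `c₀`: every presented `BothFcc` pair with bilayer frames and a
  `c₀`-admissible table satisfies the cell inequality at `(C, R₀)` (no class hypothesis at all);
* `HStripPayerPoolFaultedAt c₀ C R₀` — `HStripPayerPoolAt c₀` with `¬BothFcc σ₁ σ₂` added (the Deficit-MIN payer pool is owed for faulted
  pairs only);
* `BilayerWallResidualFaultedAt c₀ C R₀` — `BilayerWallResidualAt c₀` with `¬BothFcc σ₁ σ₂` added (the registered residual is owed for
  faulted pairs only; default owner T-F2's F_layer programme, cf-p1 (lxxxii) Q1(a));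
* inclusions `hStripPayerPoolFaultedAt_of_at`, `residualFaultedAt_of_residualAt` (unrestricted ⇒ faulted).
T-F2's two classes (`BilayerWallFaultedOnReachCoaxialAt`, `…FaultedZigCoaxialAt`, …SplitDefsV5) are faulted already.  The glue
`bilayerWallV5_of_stubsBothFccFirst` is the next file (`…TexShadowBothFccFirstGlue`).
WHAT THIS IS NOT: no proof of any wall law; F-C1 not moved.
-/

noncomputable section

open scoped BigOperators InnerProductSpace ENNReal
open MeasureTheory Filter

namespace Summit.Ventures.Crystal3D.Cruxes.TextureLiminf.TexShadow

open Summit.Ventures.Crystal3D Summit.Ventures.Crystal3D.Theorems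
open Literature.MathematicalPhysics.StatisticalMechanics (IsHaggSeq fccStacking barlowStacking contactDeficiency basalMirror)

/-- **THE `BothFcc` HALF OF THE WALL LAW AT CAP `c₀` and constants `(C, R₀)`**: every presented pair of Barlow plates whose two Hägg
words are sign-constant (`BothFcc`: both plates are fcc stackings), with bilayer frames and a `c₀`-admissible charge table, satisfies the
cell inequality — NO class hypothesis (co-axial or not, registered or not).  Closed at `c₀ ≤ 1`, `R₀ ≥ 3` from the zero cell, F-U and
lane G's uniform charge-`c₀` ledger (`bilayerWallAt_of_bothFcc_ledgerWith`). -/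
def BilayerWallBothFccAt (c₀ C R₀ : ℝ) : Prop :=
  ∀ (σ₁ σ₂ : ℤ → ℤ), IsHaggSeq σ₁ → IsHaggSeq σ₂ → BothFcc σ₁ σ₂ →
    ∀ (L₁ L₂ : E3 ≃ₗᵢ[ℝ] E3) (s₁ s₂ : E3) (A₁ A₂ : ℤ → (E3 ≃ₗᵢ[ℝ] E3)) (u₁ u₂ : ℤ → E3),
    BilayerFramesAt L₁ s₁ σ₁ A₁ u₁ → BilayerFramesAt L₂ s₂ σ₂ A₂ u₂ →
    ∀ (c : ℤ → ℤ → ℝ) (m : ℤ → ℤ → E3), BilayerChargeAdmissibleAt c₀ A₁ A₂ c m →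
      BilayerWallAt C R₀ σ₁ σ₂ L₁ L₂ s₁ s₂ c

open scoped Classical in
/-- **Deficit-MIN as a PAYER POOL at cap `c₀`, FAULTED pairs only** (`HStripPayerPoolAt c₀` with `¬BothFcc σ₁ σ₂` added): on the
Deficit-MIN class of a pair SOME plate of which carries a fault in its presented word, the whole table charge of every clamped cell of
thickness `R₀` is dominated by the payer sum. -/
def HStripPayerPoolFaultedAt (c₀ C R₀ : ℝ) : Prop :=
  ∀ (σ₁ σ₂ : ℤ → ℤ), IsHaggSeq σ₁ → IsHaggSeq σ₂ → ¬ BothFcc σ₁ σ₂ →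
    ∀ (L₁ L₂ : E3 ≃ₗᵢ[ℝ] E3) (s₁ s₂ : E3) (A₁ A₂ : ℤ → (E3 ≃ₗᵢ[ℝ] E3)) (u₁ u₂ : ℤ → E3),
    BilayerFramesAt L₁ s₁ σ₁ A₁ u₁ → BilayerFramesAt L₂ s₂ σ₂ A₂ u₂ →
    (∀ i j : ℤ, ¬ InResidualClass (A₁ i) (A₂ j) (u₁ i) (u₂ j)) →
    ∀ (c : ℤ → ℤ → ℝ) (m : ℤ → ℤ → E3), BilayerChargeAdmissibleAt c₀ A₁ A₂ c m →
      ¬ (DeltaSteep L₁ e₃ ∧ DeltaSteep L₂ (-e₃) ∧ FluxDominated (Real.sqrt 2 / 2) L₁ σ₁ L₂ σ₂ c) →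
      ¬ RowMixDominated (Real.sqrt 2 / 2) L₁ σ₁ L₂ σ₂ c →
      ¬ RowMixDominated (Real.sqrt 2 / 2) (basalMirror.trans L₁) (fun n => -σ₁ (-n - 1)) L₂ σ₂ (fun i j => c (-i - 1) j) →
      ¬ RowMixDominated (Real.sqrt 2 / 2) L₁ σ₁ (basalMirror.trans L₂) (fun n => -σ₂ (-n - 1)) (fun i j => c i (-j - 1)) →
      ¬ RowMixDominated (Real.sqrt 2 / 2) (basalMirror.trans L₁) (fun n => -σ₁ (-n - 1))
          (basalMirror.trans L₂) (fun n => -σ₂ (-n - 1)) (fun i j => c (-i - 1) (-j - 1)) →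
      ∀ h : ℝ, 0 ≤ h → ∀ ρ : ℝ, R₀ ≤ ρ → ∀ X P₁ P₂ : Finset E3,
        (∀ p ∈ X, ∀ q ∈ X, p ≠ q → 1 ≤ dist p q) → P₁ ⊆ X → P₂ ⊆ X \ P₁ → (∀ p ∈ X, p ∈ cyl R₀ h ρ) →
        (∀ p, p ∈ P₁ ↔ (p ∈ stacking L₁ s₁ σ₁ ∧ -(2 * R₀) ≤ p 2 ∧ p 2 ≤ -R₀ ∧ p 0 ^ 2 + p 1 ^ 2 ≤ ρ ^ 2)) →
        (∀ p, p ∈ P₂ ↔ (p ∈ stacking L₂ s₂ σ₂ ∧ h + R₀ ≤ p 2 ∧ p 2 ≤ h + 2 * R₀ ∧ p 0 ^ 2 + p 1 ^ 2 ≤ ρ ^ 2)) →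
        2 * (∑' ij : ℤ × ℤ, c ij.1 ij.2 *
            (volume ({q : E3 | 0 ≤ q 2 ∧ q 2 ≤ 1 ∧ q 0 ^ 2 + q 1 ^ 2 ≤ ρ ^ 2} ∩ laySlab L₁ s₁ ij.1 ∩ laySlab L₂ s₂ ij.2)).toReal) ≤
          (∑ y ∈ X.filter (fun y => (X.filter fun q => dist y q = 1).card ≠ 12 ∧ -R₀ - 2 ≤ y 2 ∧ y 2 ≤ h + R₀ + 2),
            ((12 : ℝ) - ((X.filter fun q => dist y q = 1).card : ℝ))) + C * (1 + h) * ρ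

/-- **RESIDUAL PART at cap `c₀`, FAULTED pairs only** (`BilayerWallResidualAt c₀` with `¬BothFcc σ₁ σ₂` added): a faulted pair some facing
bilayer-frame pair of which is in lane G's residual class (affinely non-co-axial, ray-aligned, outside the seven cells, registered)
satisfies the cell for `c₀`-admissible tables.  Default owner: T-F2's F_layer programme (cf-p1 (lxxxii) Q1(a)); lane G's strip-wise
question (Q1(b)) pending. -/
def BilayerWallResidualFaultedAt (c₀ C R₀ : ℝ) : Prop :=
  ∀ (σ₁ σ₂ : ℤ → ℤ), IsHaggSeq σ₁ → IsHaggSeq σ₂ → ¬ BothFcc σ₁ σ₂ →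
    ∀ (L₁ L₂ : E3 ≃ₗᵢ[ℝ] E3) (s₁ s₂ : E3) (A₁ A₂ : ℤ → (E3 ≃ₗᵢ[ℝ] E3)) (u₁ u₂ : ℤ → E3),
    BilayerFramesAt L₁ s₁ σ₁ A₁ u₁ → BilayerFramesAt L₂ s₂ σ₂ A₂ u₂ →
    (∃ i j : ℤ, InResidualClass (A₁ i) (A₂ j) (u₁ i) (u₂ j)) →
    ∀ (c : ℤ → ℤ → ℝ) (m : ℤ → ℤ → E3), BilayerChargeAdmissibleAt c₀ A₁ A₂ c m →
      BilayerWallAt C R₀ σ₁ σ₂ L₁ L₂ s₁ s₂ c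

/-- The unrestricted payer pool at cap `c₀` gives its faulted restriction (one more hypothesis). -/
theorem hStripPayerPoolFaultedAt_of_at {c₀ C R₀ : ℝ} (h : HStripPayerPoolAt c₀ C R₀) : HStripPayerPoolFaultedAt c₀ C R₀ :=
  fun σ₁ σ₂ hσ₁ hσ₂ _ => h σ₁ σ₂ hσ₁ hσ₂

/-- The unrestricted residual part at cap `c₀` gives its faulted restriction. -/
theorem residualFaultedAt_of_residualAt {c₀ C R₀ : ℝ} (h : BilayerWallResidualAt c₀ C R₀) : BilayerWallResidualFaultedAt c₀ C R₀ :=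
  fun σ₁ σ₂ hσ₁ hσ₂ _ => h σ₁ σ₂ hσ₁ hσ₂

/-- The strong (cap `1`) payer pool gives the faulted pool at every cap `c₀ ≤ 1`. -/
theorem hStripPayerPoolFaultedAt_of_pool {c₀ C R₀ : ℝ} (hc₀ : c₀ ≤ 1) (h : HStripPayerPool C R₀) :
    HStripPayerPoolFaultedAt c₀ C R₀ :=
  hStripPayerPoolFaultedAt_of_at (hStripPayerPoolAt_of_pool hc₀ h)

/-- The strong (cap `1`) residual part gives the faulted residual at every cap `c₀ ≤ 1`. -/
theorem residualFaultedAt_of_residual {c₀ C R₀ : ℝ} (hc₀ : c₀ ≤ 1) (h : BilayerWallResidual C R₀) :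
    BilayerWallResidualFaultedAt c₀ C R₀ :=
  residualFaultedAt_of_residualAt (bilayerWallResidualAt_of_residual hc₀ h)

end Summit.Ventures.Crystal3D.Cruxes.TextureLiminf.TexShadow

end
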